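import Mathlib
import Summits.QuantumFields.YangMills.Theses.BackwardLiouvilleRigidity
import Summits.QuantumFields.YangMills.Theorems.BalabanUVNodesN08Thm2AtRecordWindowExact
import Summits.QuantumFields.YangMills.Theorems.BalabanUVNodesK0VariationalThm1DatumCoupling
import Summits.QuantumFields.YangMills.Theorems.UnitScaleTiltMinimiserStabilityRegPrAvgActionDefect
import Literature.MathematicalPhysics.QuantumFieldTheory.Balaban1983to89.B10Eq38TorusDomains
import Literature.MathematicalPhysics.QuantumFieldTheory.Balaban1983to89.BlockAveragingSectionAction
import Literature.MathematicalPhysics.QuantumFieldTheory.Balaban1983to89.T3DescentFibreTower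

/-!
# REFUTATION LINE «twisted-fibre» against the organ `OneStepBackwardContraction` (stmt-QuantumFields-27939, rev 4) of route
# `route-QuantumFields-BackwardLiouvilleRigidity` — ym-r3-idea-1 g11 (refuter support, NOTE #117 (c)); no summit / rung / crux is proved.

THE FINDING.  The organ quantifies over ALL pairs of consistent trajectories `(μ,ρ)`, `(μ',ρ')` whose densities satisfy the class clauses
(window positivity, `withDensity`, `MemAtHeight F ℰp j (prm j)` for an ARBITRARY schedule `prm`, window tails, continuity on the window),
for ALL `b₀ p₀ κ`.  Nothing in these hypotheses pins the ONE-STEP FIBRE LAWS `m'_V` of the reference trajectory (the conditional law of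
`μ' (j+1)` given `descend = V`): a consistent trajectory is built UPWARD by arbitrary unit kernels (§2), and with degenerate parameters
(`δ = 0`: the all-small window of the WITNESS is empty, `nDom = 0`, `lf = 0`) `MemAtHeight` only asks non-negativity, measurability,
gauge invariance and a bound `r ≤ e^{c5|T|}` (§1, PROVED).  Tilting the reference kernels along the fine Wilson functional
`A_{j+1} = β_{j+1} a_{j+1} Σ_p (1 − Re tr U_p)` one can make `log⟨e^{A_{j+1}}⟩_{m'_V} = A_j(V) + κ_j` with `a_j = 2L²·a_{j+1}` FOR
EVERY `V` (the matching equation `log Λ_V(1+t) − log Λ_V(t) = A_j(V) + κ_j` is solvable iff `β_{j+1}a_{j+1}·min_fibre Σ(1−Re tr) < A_j(V) + κ_j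
< β_{j+1}a_{j+1}·sup_fibre Σ(1−Re tr)`; the explicit SLICE LIFT of `V` has fine action `L·Σ_P(1 − Re tr V_P)`, so the lower bound holds for
ratio `2L²` and every `V` with a tiny `κ_j > 0`; the upper bound is the WILD-LIFT lemma `sup ≥ c₀·#Plaq_{j+1}`, `c₀ > 6/L²`, by `g/g⁻¹`
insertions along block lines — `F.L` is the refuter's choice), i.e. a pair whose log-ratio is EXACTLY affine at every height with
coefficient growing downward by the fixed ratio `2L²` (`stub_twistedPair`; the stub only records ratios in `[2, L⁶]`, which is all
the reduction uses).  On the window of height `j` an exactly affine log-ratio of coefficient `a` admits no admissible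
decomposition `(c', a', w')` with `a' + θ·w' < a` once `4·p(g_j)² ≥ 1/θ` (`stub_affineRigidity`: one-bond first differences, `β_j θ_j² =
p(g_j)² → ∞` for `p₀ > 0`).  The organ's conclusion would give `a' + θw' ≤ (1 + ε_j + C a_{j+1}) a_{j+1} + δ_j` with `ε_j → 0` and a floor
`δ_j = o(L^{-6j})` (forced by its own `Tendsto` clause), contradicting `a_j ≥ 2a_{j+1}` (floor `δ_j ≤ a_{j+1}/4` from the clause's volume factor `≥ #PBond_j² ≥ L^{6j}`, `volumeFactor_ge'`, and `a_{j+1} ≥ a_0L^{-6(j+1)}`) — `not_oneStepBackwardContraction_of_stubs : ¬ OneStepBackwardContraction`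
(kernel-checked modulo the ONE construction stub `stub_twistedPair`; everything else in this file is proved).  REPAIR (planner side, not filed): the refutation is of the organ AS TYPED (`∀ prm : ℕ → ClassParams`, membership made
vacuous by `δ = 0`); the minimal hygiene `AdmissibleClassParams F γ b₀ p₀ prm → 0 < b₀ → 0 < p₀ →` already cuts the kernel freedom down to an activity budget under
which the twist ratio is `1 + O(L³·C₀·θBal²)` (summable, absorbed by the organ's `ε_j`) — coupled with strengthening A♯ (22541) to deliver admissible `prm`; the
PROOF will need the localised class (quasi-local analytic effective action, Bałaban's inductive step).  See `organ_twisted_fibre.md` §5 (corrected).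
-/

namespace Summit.QuantumFields.YangMills.Cruxes.OneStepBackwardContraction.TwistedFibre

open scoped BigOperators Topology Classical MeasureTheory Matrix ENNReal NNReal
open Filter Set Function TopologicalSpace MeasureTheory
open Summit.QuantumFields.YangMills.Theses.BackwardLiouvilleRigidity
open Literature.MathematicalPhysics.QuantumFieldTheory.Balaban1983to89 T3ContinuumYM3Torus T3NestedUnitLaws T3UnitLawDensityEML
  T4Continuum BalabanUVClass T3UnitScaleTilt T3LevelShift

/-! ## §1 Degenerate parameters: membership in the class is free (PROVED) -/

/-- Degenerate class parameters: empty all-small window (`δ = 0`, `PlaqSmall` is strict), no domains, no large-field content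
(`cLF = 0`, `δL = 3 > 2 ≥ dist1`), stability constant `c5`. -/
def degenerateParams (c5 : ℝ) : ClassParams :=
  { δ := 0, δreg := 0, δL := 3, β := 0, κ := 0, M := 0, Ccov := 0, cE := 0, slack := 0, cLF := 0, c5 := c5 }

/-- A plaquette of any lattice of a `T3Family` (d = 3). -/
def somePlaq (F : T3Family) (K k : ℕ) : Plaq (F.P K) k :=
  ⟨fun _ => 0, ⟨0, by simp⟩, ⟨1, by simp⟩, by simp⟩

/-- With `δ = 0` no configuration is all-small. -/
theorem not_plaqSmall_zero (F : T3Family) (K k : ℕ) {G : Type*} [GaugeGroup G] (V : GaugeField (F.P K) k G) :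
    ¬ PlaqSmall (0 : ℝ) V := fun h =>
  (not_lt.mpr (GaugeGroup.dist1_nonneg (GaugeField.plaqHol V (somePlaq F K k)))) (h (somePlaq F K k))

/-- **MEMBERSHIP IS FREE FOR DEGENERATE PARAMETERS**: every non-negative measurable gauge-invariant density bounded by `e^{c5|T|}` is a
member of Bałaban's class at height `j` with parameters `degenerateParams c5` (witness run `K = j`, no renormalization step). -/
theorem memAtHeight_degenerate (F : T3Family) (j : ℕ)
    (r : GaugeField (F.P j) 0 (Matrix.specialUnitaryGroup (Fin 2) ℂ) → ℝ) (c5 : ℝ)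
    (h0 : ∀ V, 0 ≤ r V) (hm : Measurable r) (hg : GaugeField.GaugeInvariant r)
    (hb : ∀ V, r V ≤ Real.exp (c5 * Fintype.card (Site (F.P j) (j - j)))) :
    MemAtHeight F ℰp j (degenerateParams c5) r := by
  refine ⟨j, le_rfl, ⟨?_⟩⟩
  refine
    { bg := fun _ _ => 1
      nDom := 0
      supp := fun X => X.elim0
      foot := fun X => X.elim0
      len := fun X => X.elim0
      wt := fun X => X.elim0
      act := fun X => X.elim0
      cst := 0
      lf := fun _ => 0
      nonneg := fun W => ?_
      measurable := measurable_readAtLevel F le_rfl hm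
      gaugeInvariant := fun u W => ?_
      isBackground := fun V hV => (not_plaqSmall_zero F j (j - j) V hV).elim
      foot_nonempty := fun X => X.elim0
      supp_foot := fun X => X.elim0
      len_nonneg := fun X => X.elim0
      wt_nonneg := fun X => X.elim0
      diam_foot := fun X => X.elim0
      act_local := fun X => X.elim0
      act_gaugeInvariant := fun X => X.elim0
      act_bound := fun X => X.elim0
      cover := fun y => by simp [degenerateParams]
      cst_abs_le := by simp [degenerateParams]
      lower := fun V hV => (not_plaqSmall_zero F j (j - j) V hV).elim
      upper := fun V hV => (not_plaqSmall_zero F j (j - j) V hV).elim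
      lf_nonneg := fun _ => le_rfl
      lf_le := fun _ => by show (0:ℝ) ≤ _; positivity
      large := fun W S _ => ?_ }
  · exact h0 _
  · show r (fieldShift _ (GaugeField.gaugeAct u W)) = r (fieldShift _ W)
    rw [fieldShift_gaugeAct]
    exact hg _ _
  · have : Real.exp (-((degenerateParams c5).cLF * (S.card : ℝ))) = 1 := by simp [degenerateParams]
    rw [this, one_mul]
    exact hb _

/-! ## §2 Consistent trajectories are built upward by arbitrary unit kernels (PROVED) -/

/-- **UNIT-KERNEL EXTENSION**: if `q ≥ 0` is a unit kernel density for `descend` (the push-forward of `q·dU_{j+1}` is `dU_j`) then for every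
density `ρ ≥ 0` at height `j` the measure `(ρ ∘ descend)·q·dU_{j+1}` pushes forward to `ρ·dU_j`: one step UP of a consistent trajectory,
with the fibre laws of the new top level prescribed by `q` — nothing else constrains them. -/
theorem map_descend_withDensity_mul (F : T3Family) (j : ℕ)
    (q : GaugeField (F.P (j + 1)) 0 (Matrix.specialUnitaryGroup (Fin 2) ℂ) → ℝ≥0∞) (hq : Measurable q)
    (hunit : Measure.map (descend F ℰp j) ((fieldMeasure (F.P (j + 1)) 0 _).withDensity q) = fieldMeasure (F.P j) 0 _)
    (ρ : GaugeField (F.P j) 0 (Matrix.specialUnitaryGroup (Fin 2) ℂ) → ℝ≥0∞) (hρ : Measurable ρ) :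
    Measure.map (descend F ℰp j) ((fieldMeasure (F.P (j + 1)) 0 _).withDensity (fun U => ρ (descend F ℰp j U) * q U)) =
      (fieldMeasure (F.P j) 0 _).withDensity ρ := by
  have hD : Measurable (descend F ℰp j) := measurable_descend F ℰp measurableE_ℰp j
  ext s hs
  rw [Measure.map_apply hD hs, withDensity_apply _ (hD hs), withDensity_apply _ hs]
  have h1 : ∫⁻ U in descend F ℰp j ⁻¹' s, ρ (descend F ℰp j U) * q U ∂fieldMeasure (F.P (j + 1)) 0 _ =
      ∫⁻ U, (s.indicator ρ) (descend F ℰp j U) ∂(fieldMeasure (F.P (j + 1)) 0 _).withDensity q := by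
    rw [lintegral_withDensity_eq_lintegral_mul _ hq
      (show Measurable (fun U => s.indicator ρ (descend F ℰp j U)) from (hρ.indicator hs).comp hD),
      ← lintegral_indicator (hD hs)]
    congr 1
    funext U
    by_cases hU : descend F ℰp j U ∈ s <;> simp [Set.indicator_apply, hU, mul_comm]
  rw [h1, ← lintegral_map ((hρ.indicator hs)) hD, hunit, lintegral_indicator hs]

/-! ## §2b The SLICE LIFT of the blueprint is the tree's FACE SECTION (critic NOTE #134 (ii), «run the cheapest falsifier»: RUN, PASSES)

The blueprint's slice lift `U^{sl}(V)` (coarse bond variable on the last fine bond of each block line, `1` elsewhere) is literally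
`BlockAveragingSection.faceSec` (value `V ⟨blockOf x, μ⟩` on the fine bonds EXITING their block).  The tree PROVES, for every small-loop
average with `ℰ(1,…,1) = 1` — in particular the printed `exp[mean log]` `ℰp` (`T3DescentFibreTower.expMeanLogSU_E_one`) — that it is an
exact section of the (0.4) averaging (`blockAvg_faceSec`: the loop family of (0.4) is identically `1` on it, by a pure-gauge argument), and
that its Wilson action is `L^{d−2}` times the coarse one (`BlockAveragingSectionAction.wilsonAction4_faceSec`; `d = 3`: factor `L`).  Read
through the level identification `fieldShift` of `descend`, this is EXACTLY input (S) of the blueprint: `descend (U^{sl} V) = V` and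
`S_{j+1}(U^{sl} V) = L·S_j(V)`, for EVERY odd `L` (so in particular at `L = 3`) and the tree's concrete `ℰp`. -/

open Literature.MathematicalPhysics.QuantumFieldTheory.Balaban1983to89.BlockAveragingSection (faceSec blockAvg_faceSec)
open Literature.MathematicalPhysics.QuantumFieldTheory.Balaban1983to89.BlockAveragingSectionAction (wilsonAction4_faceSec)
open Literature.MathematicalPhysics.QuantumFieldTheory.Balaban1983to89.T3DescentFibreTower (expMeanLogSU_E_one)

/-- THE SLICE LIFT of a configuration of the `j`-th unit lattice to the `(j+1)`-th: the face section of its copy one level up. -/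
def sliceLift (F : T3Family) (j : ℕ) {G : Type*} [GaugeGroup G] (V : GaugeField (F.P j) 0 G) : GaugeField (F.P (j + 1)) 0 G :=
  faceSec (fieldShift (sitesPerDir_descend F j 0).symm V)

/-- **(S), first half — PROVED FROM THE TREE: the slice lift is an exact right inverse of `descend` at the printed smearing `ℰp`.** -/
theorem descend_sliceLift (F : T3Family) (j : ℕ) (V : GaugeField (F.P j) 0 (Matrix.specialUnitaryGroup (Fin 2) ℂ)) :
    descend F ℰp j (sliceLift F j V) = V := by
  have hj : 0 + 1 ≤ (F.P (j + 1)).m + (F.P (j + 1)).K := by show 0 + 1 ≤ F.m + (j + 1); omega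
  exact (congrArg (fieldShift (sitesPerDir_descend F j 0))
    (blockAvg_faceSec hj ℰp expMeanLogSU_E_one (fieldShift (sitesPerDir_descend F j 0).symm V))).trans
    (fieldShift_symm_fieldShift _ V)

/-- **(S), second half — PROVED FROM THE TREE: the fine Wilson action of the slice lift is EXACTLY `L` times the coarse one** (`d = 3`). -/
theorem wilsonAction4_sliceLift (F : T3Family) (j : ℕ) {G : Type*} [GaugeGroup G] (V : GaugeField (F.P j) 0 G) :
    wilsonAction4 (sliceLift F j V) = (F.L : ℝ) * wilsonAction4 V := by
  have hj : 0 + 1 ≤ (F.P (j + 1)).m + (F.P (j + 1)).K := by show 0 + 1 ≤ F.m + (j + 1); omega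
  have hA : wilsonAction4 (sliceLift F j V) =
      ((F.L : ℝ)) ^ (3 - 2) * wilsonAction4 (fieldShift (sitesPerDir_descend F j 0).symm V) :=
    wilsonAction4_faceSec hj _
  have hB : wilsonAction4 (fieldShift (sitesPerDir_descend F j 0).symm V) = wilsonAction4 V :=
    wilsonAction_fieldShift _ 1 V
  rw [hA, hB]
  norm_num

/-- The same in the normalisation of the organ's Wilson functional `Σ_p (1 − Re tr U_p)` (constant coefficient pulled out). -/
theorem sum_one_sub_reTr_sliceLift (F : T3Family) (j : ℕ) {G : Type*} [GaugeGroup G] (V : GaugeField (F.P j) 0 G) :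
    ∑ p : Plaq (F.P (j + 1)) 0, (1 - GaugeGroup.reTr (GaugeField.plaqHol (sliceLift F j V) p)) =
      (F.L : ℝ) * ∑ p : Plaq (F.P j) 0, (1 - GaugeGroup.reTr (GaugeField.plaqHol V p)) := by
  have h := wilsonAction4_sliceLift F j V
  simp only [wilsonAction4, wilsonAction, one_mul] at h
  exact h

/-! ## §3 The construction stub, the proved rigidity, and the kernel-checked reduction -/

/-- stub (XL, the construction): THE TWISTED PAIR.  For every `γ₁ > 0` there are a family, a coupling `γ ≤ min γ₁ 1`, `b₀ > 0`, `p₀ > 0`,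
degenerate schedules and two consistent trajectories satisfying every clause of the organ from height `j₀`, whose log-ratio is EXACTLY
affine on every window, `log ρ_j − log ρ'_j = β_j a_j Σ_p (1 − Re tr U_p) + k_j`, with `a_j > 0` and ratios `2 ≤ a_j/a_{j+1} ≤ L⁶`
(the blueprint uses `a_j = 2L²·a_{j+1}`; any ratio law in the window serves the reduction).  Construction
(blueprint with constants: `organ_twisted_fibre.md` §6): `F.L` large odd; reference kernels `dm'_V ∝ e^{t(V) A_{j+1}} ψ_{j+1} dσ_V` (`σ_V` the
Haar fibre law of `descend`, `ψ_{j+1} = exp(−b_{j+1}β_{j+1}Σ_p(1 − Re tr U_p))` an everywhere-positive fibre-Wilson damping with `b_{j+1}`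
large, `t(V) ≥ 0` the unique solution of `log⟨e^{A_{j+1}}⟩_{t} − log⟨1⟩_{t} = A_j(V) + κ_j`, solvable for EVERY `V` by the slice-lift /
wild-lift bounds), `μ = e^{A + k} μ'` heightwise; consistency by `map_descend_withDensity_mul`; membership by `memAtHeight_degenerate`;
tails by induction on typical sets (under the matched fibre law of a typical `V` the fine plaquettes live at scale `(2/L²)·`coarse scale,
geometrically below `θBal²_{j+1}`, union bound with `p₀ = 1`); continuity on windows from continuity of fibre integrals. -/
theorem stub_twistedPair :
    ∀ γ₁ : ℝ, 0 < γ₁ → ∃ (F : T3Family) (γ : ℝ), 0 < γ ∧ γ ≤ γ₁ ∧ γ ≤ 1 ∧ ∃ (b₀ p₀ : ℝ), 0 < b₀ ∧ 0 < p₀ ∧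
    ∃ (κ : ℝ) (j₀ : ℕ) (prm : ℕ → ClassParams) (η : ℕ → ℝ), 0 < κ ∧ (∀ j, 0 ≤ η j) ∧ Summable η ∧
    ∃ (μ μ' : ((j : ℕ) → MeasureTheory.Measure (GaugeField (F.P j) 0 ↥(Matrix.specialUnitaryGroup (Fin 2) ℂ))))
      (ρ ρ' : ((j : ℕ) → GaugeField (F.P j) 0 ↥(Matrix.specialUnitaryGroup (Fin 2) ℂ) → ℝ)),
    (∀ j : ℕ, IsProbabilityMeasure (μ j) ∧ μ j = Measure.map (descend F ℰp j) (μ (j + 1))) ∧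
    (∀ j : ℕ, IsProbabilityMeasure (μ' j) ∧ μ' j = Measure.map (descend F ℰp j) (μ' (j + 1))) ∧
    (∀ j : ℕ, j₀ ≤ j → ((∀ U, PlaqSmall (θBal F.L γ b₀ p₀ j) U → 0 < ρ j U ∧ 0 < ρ' j U) ∧ μ j = (fieldMeasure _ _ _).withDensity (fun U => ENNReal.ofReal (ρ j U)) ∧ μ' j = (fieldMeasure _ _ _).withDensity (fun U => ENNReal.ofReal (ρ' j U)) ∧ MemAtHeight F ℰp j (prm j) (ρ j) ∧ MemAtHeight F ℰp j (prm j) (ρ' j) ∧ μ j {U | ¬ PlaqSmall (θBal F.L γ b₀ p₀ j) U} ≤ ENNReal.ofReal (η j) ∧ μ' j {U | ¬ PlaqSmall (θBal F.L γ b₀ p₀ j) U} ≤ ENNReal.ofReal (η j) ∧ (ContinuousOn (ρ j) {U | PlaqSmall (θBal F.L γ b₀ p₀ j) U} ∧ ContinuousOn (ρ' j) {U | PlaqSmall (θBal F.L γ b₀ p₀ j) U}))) ∧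
    ∃ (a k : ℕ → ℝ), (∀ j, 0 < a j) ∧ (∀ j, 2 * a (j + 1) ≤ a j ∧ a j ≤ (F.L : ℝ) ^ 6 * a (j + 1)) ∧
    (∀ (j : ℕ) (U : GaugeField (F.P j) 0 ↥(Matrix.specialUnitaryGroup (Fin 2) ℂ)), PlaqSmall (θBal F.L γ b₀ p₀ j) U →
      Real.log (ρ j U) - Real.log (ρ' j U) = ((F.L : ℝ) ^ j / γ) * ∑ p, a j * (1 - reTr (GaugeField.plaqHol U p)) + k j) := by
  sorry

/-- **AFFINE RIGIDITY ON THE WINDOW** (PROVED; was the line's M-stub).  For `p₀ > 0` the window functional `β_j Σ_p a(1 − Re tr U_p)` of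
coefficient `a` has no admissible decomposition `(c', a', w')` with `a' + θ w' < a` at large heights: the one-bond first difference at the
flat configuration inside the window (`b = b'`, `W = Z = U`) gives `β_j·(1 − Re tr g)·(a − a') ≤ w'` with `1 − Re tr g = |g − 1|²/2`
(`SU(2)`), `|g − 1| = min(θ_j/2, 1)`, and `β_j θ_j² = p(g_j)² → ∞`, `β_j → ∞`. -/
theorem affineRigidity :
    ∀ (F : T3Family) (γ b₀ p₀ : ℝ), 0 < γ → γ ≤ 1 → 0 < b₀ → 0 < p₀ → ∀ θ : ℝ, 0 < θ → ∃ j₂ : ℕ, ∀ j : ℕ, j₂ ≤ j →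
    ∀ (κ a a' w' k : ℝ) (c' : Plaq (F.P j) 0 → ℝ), 0 ≤ a → 0 ≤ a' → 0 ≤ w' → (∀ p, |c' p| ≤ a') →
    (∀ (b b' : PBond (F.P j) 0) (U V W Z : GaugeField (F.P j) 0 ↥(Matrix.specialUnitaryGroup (Fin 2) ℂ)), PlaqSmall (θBal F.L γ b₀ p₀ j) U → PlaqSmall (θBal F.L γ b₀ p₀ j) V → PlaqSmall (θBal F.L γ b₀ p₀ j) W → PlaqSmall (θBal F.L γ b₀ p₀ j) Z → (∀ e, e ≠ b → U e = V e) → (∀ e, e ≠ b' → U e = W e) → (∀ e, e ≠ b' → V e = Z e) → (∀ e, e ≠ b → W e = Z e) →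
      |((((F.L : ℝ) ^ j / γ) * ∑ p, a * (1 - reTr (GaugeField.plaqHol U p)) + k) - ((F.L : ℝ) ^ j / γ) * ∑ p, c' p * (1 - reTr (GaugeField.plaqHol U p))) - ((((F.L : ℝ) ^ j / γ) * ∑ p, a * (1 - reTr (GaugeField.plaqHol V p)) + k) - ((F.L : ℝ) ^ j / γ) * ∑ p, c' p * (1 - reTr (GaugeField.plaqHol V p))) - (((((F.L : ℝ) ^ j / γ) * ∑ p, a * (1 - reTr (GaugeField.plaqHol W p)) + k) - ((F.L : ℝ) ^ j / γ) * ∑ p, c' p * (1 - reTr (GaugeField.plaqHol W p))) - ((((F.L : ℝ) ^ j / γ) * ∑ p, a * (1 - reTr (GaugeField.plaqHol Z p)) + k) - ((F.L : ℝ) ^ j / γ) * ∑ p, c' p * (1 - reTr (GaugeField.plaqHol Z p))))| ≤ w' * Real.exp (-(κ * (b.src.tdist b'.src : ℝ)))) →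
    a ≤ a' + θ * w' := by
  intro F γ b₀ p₀ hγ hγ1 hb₀ hp₀ θ hθ
  have hL1 : (1 : ℝ) < (F.L : ℝ) := by exact_mod_cast F.hL.2
  have hL0 : (F.L : ℝ) ≠ 0 := by positivity
  have hlogL : 0 < Real.log (F.L : ℝ) := Real.log_pos hL1
  have hlogγ : Real.log γ ≤ 0 := Real.log_nonpos hγ.le hγ1
  -- the closed form of `log g_j⁻¹`, `g_j = √(γ L^{-j})`
  have hq0 : 0 < ((F.L : ℝ)⁻¹) := by positivity
  have hlog : ∀ j : ℕ, Real.log (Real.sqrt (γ * ((F.L : ℝ)⁻¹) ^ j))⁻¹ = ((j : ℝ) * Real.log (F.L : ℝ) - Real.log γ) / 2 := by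
    intro j
    rw [Real.log_inv, Real.log_sqrt (by positivity), Real.log_mul hγ.ne' (by positivity), Real.log_pow, Real.log_inv]
    ring
  -- (I) `p(g_j) → ∞`
  have hP : Tendsto (fun j : ℕ => B10.pFun b₀ p₀ (Real.sqrt (γ * ((F.L : ℝ)⁻¹) ^ j))) atTop atTop := by
    have h1 : Tendsto (fun j : ℕ => 1 + ((j : ℝ) * Real.log (F.L : ℝ) - Real.log γ) / 2) atTop atTop := by
      have : Tendsto (fun j : ℕ => (j : ℝ) * (Real.log (F.L : ℝ) / 2) + (1 - Real.log γ / 2)) atTop atTop :=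
        tendsto_atTop_add_const_right _ _ (tendsto_natCast_atTop_atTop.atTop_mul_const (by positivity))
      refine this.congr fun j => by ring
    have h2 := (tendsto_rpow_atTop hp₀).comp h1
    have h3 := h2.const_mul_atTop hb₀
    refine h3.congr fun j => ?_
    simp only [Function.comp, B10.pFun, hlog j]
  obtain ⟨N₁, hN₁⟩ : ∃ N, ∀ j : ℕ, N ≤ j → max 1 (8 / θ) ≤ B10.pFun b₀ p₀ (Real.sqrt (γ * ((F.L : ℝ)⁻¹) ^ j)) :=
    eventually_atTop.mp (hP.eventually_ge_atTop _)
  -- (II) `β_j → ∞`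
  obtain ⟨N₂, hN₂⟩ : ∃ N, ∀ j : ℕ, N ≤ j → 2 * γ / θ ≤ (F.L : ℝ) ^ j :=
    eventually_atTop.mp ((tendsto_pow_atTop_atTop_of_one_lt hL1).eventually_ge_atTop _)
  refine ⟨max N₁ N₂, fun j hj κ a a' w' k c' ha ha' hw' hc' hclause => ?_⟩
  by_cases haa : a ≤ a'
  · nlinarith [mul_nonneg hθ.le hw']
  rw [not_le] at haa
  have hjN1 : N₁ ≤ j := le_trans (le_max_left _ _) hj
  have hjN2 : N₂ ≤ j := le_trans (le_max_right _ _) hj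
  -- the window radius is positive
  have hlogj : 0 ≤ Real.log (Real.sqrt (γ * ((F.L : ℝ)⁻¹) ^ j))⁻¹ := by
    rw [hlog j]
    have : 0 ≤ (j : ℝ) * Real.log (F.L : ℝ) := by positivity
    linarith
  have hPpos : 0 < B10.pFun b₀ p₀ (Real.sqrt (γ * ((F.L : ℝ)⁻¹) ^ j)) := by
    unfold B10.pFun
    exact mul_pos hb₀ (Real.rpow_pos_of_pos (by linarith) _)
  have hθj : 0 < θBal F.L γ b₀ p₀ j := by
    unfold θBal
    exact mul_pos (Real.sqrt_pos.mpr (by positivity)) hPpos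
  -- `β_j θ_j² = p(g_j)²`
  have hβθ : (F.L : ℝ) ^ j / γ * θBal F.L γ b₀ p₀ j ^ 2 = B10.pFun b₀ p₀ (Real.sqrt (γ * ((F.L : ℝ)⁻¹) ^ j)) ^ 2 := by
    unfold θBal
    rw [mul_pow, Real.sq_sqrt (by positivity), inv_pow]
    field_simp
  -- the group element and the two configurations
  set r : ℝ := min (θBal F.L γ b₀ p₀ j / 2) 1 with hr
  have hr0 : 0 ≤ r := le_min (by linarith) zero_le_one
  have hr2 : r ≤ 2 := le_trans (min_le_right _ _) (by norm_num)
  have hrθ : r < θBal F.L γ b₀ p₀ j := lt_of_le_of_lt (min_le_left _ _) (by linarith)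
  obtain ⟨g, hg⟩ := Theorems.K0VariationalThm1DatumCoupling.exists_su_dist1_eq (N := 2) le_rfl hr0 hr2
  have hd0 : 0 < (F.P j).d := by simp
  have hd1 : 1 < (F.P j).d := by simp
  have hμν : (⟨0, hd0⟩ : Fin (F.P j).d) < ⟨1, hd1⟩ := Fin.mk_lt_mk.mpr zero_lt_one
  obtain ⟨U, hU₀, hU⟩ :=
    BalabanUVNodes.N08Thm2AtRecordWindowNecessity.exists_oneBond (⟨(fun _ => 0 : Site (F.P j) 0), ⟨0, hd0⟩⟩ : PBond (F.P j) 0) g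
  obtain ⟨V, hV₀, hV⟩ :=
    BalabanUVNodes.N08Thm2AtRecordWindowNecessity.exists_oneBond (⟨(fun _ => 0 : Site (F.P j) 0), ⟨0, hd0⟩⟩ : PBond (F.P j) 0)
      (1 : ↥(Matrix.specialUnitaryGroup (Fin 2) ℂ))
  have hUw : PlaqSmall (θBal F.L γ b₀ p₀ j) U :=
    BalabanUVNodes.N08Thm2AtRecordWindowExact.plaqSmall_oneBond hU hU₀ (by rw [hg]; exact hrθ)
  have hVw : PlaqSmall (θBal F.L γ b₀ p₀ j) V :=
    BalabanUVNodes.N08Thm2AtRecordWindowExact.plaqSmall_oneBond hV hV₀ (by rw [GaugeGroup.dist1_one]; exact hθj)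
  -- the remainder clause at `b = b'`, `W = Z = U`: a first difference along the bond
  have hcl := hclause ⟨(fun _ => 0 : Site (F.P j) 0), ⟨0, hd0⟩⟩ ⟨(fun _ => 0 : Site (F.P j) 0), ⟨0, hd0⟩⟩ U V U U hUw hVw hUw hUw
    (fun e he => by rw [hU e he, hV e he]) (fun _ _ => rfl) (fun e he => by rw [hU e he, hV e he]) (fun _ _ => rfl)
  have ht0 : (Site.tdist (PBond.src (⟨(fun _ => 0 : Site (F.P j) 0), ⟨0, hd0⟩⟩ : PBond (F.P j) 0))
      (PBond.src (⟨(fun _ => 0 : Site (F.P j) 0), ⟨0, hd0⟩⟩ : PBond (F.P j) 0)) : ℝ) = 0 := by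
    rw [B10Eq38TorusDomains.tdist_self]; simp
  rw [ht0, mul_zero, neg_zero, Real.exp_zero, mul_one, sub_self, sub_zero] at hcl
  -- the flat configuration contributes nothing
  have hV1 : ∀ p : Plaq (F.P j) 0, GaugeField.plaqHol V p = 1 := by
    intro p
    rcases BalabanUVNodes.N08Thm2AtRecordWindowExact.plaqHol_oneBond_cases hV hV₀ p with h | h | h
    · exact h
    · exact h
    · rw [h, inv_one]
  have hVs1 : ∑ p : Plaq (F.P j) 0, a * (1 - reTr (GaugeField.plaqHol V p)) = 0 := by
    simp [hV1, GaugeGroup.reTr_one]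
  have hVs2 : ∑ p : Plaq (F.P j) 0, c' p * (1 - reTr (GaugeField.plaqHol V p)) = 0 := by
    simp [hV1, GaugeGroup.reTr_one]
  rw [hVs1, hVs2] at hcl
  -- the one-bond configuration: `Σ_p (a − c'_p)(1 − Re tr U_p) ≥ (a − a')(1 − Re tr g)`
  have hdiff : ∑ p : Plaq (F.P j) 0, a * (1 - reTr (GaugeField.plaqHol U p)) -
      ∑ p : Plaq (F.P j) 0, c' p * (1 - reTr (GaugeField.plaqHol U p)) =
      ∑ p : Plaq (F.P j) 0, (a - c' p) * (1 - reTr (GaugeField.plaqHol U p)) := by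
    rw [← Finset.sum_sub_distrib]
    refine Finset.sum_congr rfl fun p _ => by ring
  have hterm : ∀ p : Plaq (F.P j) 0, 0 ≤ (a - c' p) * (1 - reTr (GaugeField.plaqHol U p)) := by
    intro p
    have h1 : c' p ≤ a' := le_trans (le_abs_self _) (hc' p)
    have h2 : reTr (GaugeField.plaqHol U p) ≤ 1 := GaugeGroup.reTr_le_one _
    exact mul_nonneg (by linarith) (by linarith)
  have hself : GaugeField.plaqHol U ⟨(fun _ => 0 : Site (F.P j) 0), ⟨0, hd0⟩, ⟨1, hd1⟩, hμν⟩ = g :=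
    BalabanUVNodes.N08Thm2AtRecordWindowNecessity.plaqHol_oneBond_self hμν hU hU₀
  have hg2 : 1 - reTr g = 1 / 2 * r ^ 2 := by
    rw [Theorems.AvgActionDefect.one_sub_reTr_eq_half_dist1_sq_su2, hg]
  have hsum : (a - a') * (1 / 2 * r ^ 2) ≤ ∑ p : Plaq (F.P j) 0, (a - c' p) * (1 - reTr (GaugeField.plaqHol U p)) := by
    have hp1 : c' ⟨(fun _ => 0 : Site (F.P j) 0), ⟨0, hd0⟩, ⟨1, hd1⟩, hμν⟩ ≤ a' := le_trans (le_abs_self _) (hc' _)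
    calc (a - a') * (1 / 2 * r ^ 2)
        ≤ (a - c' ⟨(fun _ => 0 : Site (F.P j) 0), ⟨0, hd0⟩, ⟨1, hd1⟩, hμν⟩) *
            (1 - reTr (GaugeField.plaqHol U ⟨(fun _ => 0 : Site (F.P j) 0), ⟨0, hd0⟩, ⟨1, hd1⟩, hμν⟩)) := by
          rw [hself, hg2]
          exact mul_le_mul_of_nonneg_right (by linarith) (by positivity)
      _ ≤ ∑ p : Plaq (F.P j) 0, (a - c' p) * (1 - reTr (GaugeField.plaqHol U p)) :=
          Finset.single_le_sum (f := fun p : Plaq (F.P j) 0 => (a - c' p) * (1 - reTr (GaugeField.plaqHol U p)))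
            (fun p _ => hterm p) (Finset.mem_univ _)
  -- chain: `β_j (a − a') r²/2 ≤ E U − E V ≤ w'`
  have hβ : 0 < (F.L : ℝ) ^ j / γ := by positivity
  have hmain : (F.L : ℝ) ^ j / γ * ((a - a') * (1 / 2 * r ^ 2)) ≤ w' := by
    have e : ((F.L : ℝ) ^ j / γ * ∑ p : Plaq (F.P j) 0, a * (1 - reTr (GaugeField.plaqHol U p)) + k) -
        (F.L : ℝ) ^ j / γ * ∑ p : Plaq (F.P j) 0, c' p * (1 - reTr (GaugeField.plaqHol U p)) -
        (((F.L : ℝ) ^ j / γ * 0 + k) - (F.L : ℝ) ^ j / γ * 0) =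
        (F.L : ℝ) ^ j / γ * ∑ p : Plaq (F.P j) 0, (a - c' p) * (1 - reTr (GaugeField.plaqHol U p)) := by
      rw [← hdiff]; ring
    calc (F.L : ℝ) ^ j / γ * ((a - a') * (1 / 2 * r ^ 2))
        ≤ (F.L : ℝ) ^ j / γ * ∑ p : Plaq (F.P j) 0, (a - c' p) * (1 - reTr (GaugeField.plaqHol U p)) :=
          mul_le_mul_of_nonneg_left hsum hβ.le
      _ = _ := e.symm
      _ ≤ _ := le_abs_self _
      _ ≤ w' := hcl
  -- the coefficient `β_j r² θ / 2 ≥ 1`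
  have hcoef : 1 ≤ (F.L : ℝ) ^ j / γ * (1 / 2 * r ^ 2) * θ := by
    by_cases hcase : θBal F.L γ b₀ p₀ j / 2 ≤ 1
    · have hrr : r = θBal F.L γ b₀ p₀ j / 2 := min_eq_left hcase
      have h8 : 8 / θ ≤ B10.pFun b₀ p₀ (Real.sqrt (γ * ((F.L : ℝ)⁻¹) ^ j)) := le_trans (le_max_right _ _) (hN₁ j hjN1)
      have h1' : 1 ≤ B10.pFun b₀ p₀ (Real.sqrt (γ * ((F.L : ℝ)⁻¹) ^ j)) := le_trans (le_max_left _ _) (hN₁ j hjN1)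
      rw [div_le_iff₀ hθ] at h8
      have hsq : 8 ≤ B10.pFun b₀ p₀ (Real.sqrt (γ * ((F.L : ℝ)⁻¹) ^ j)) ^ 2 * θ := by nlinarith
      rw [hrr]
      have : (F.L : ℝ) ^ j / γ * (1 / 2 * (θBal F.L γ b₀ p₀ j / 2) ^ 2) * θ =
          ((F.L : ℝ) ^ j / γ * θBal F.L γ b₀ p₀ j ^ 2) * θ / 8 := by ring
      rw [this, hβθ]
      linarith
    · rw [not_le] at hcase
      have hrr : r = 1 := min_eq_right hcase.le
      have h2 := hN₂ j hjN2
      rw [div_le_iff₀ hθ] at h2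
      rw [hrr]
      have : (F.L : ℝ) ^ j / γ * (1 / 2 * (1 : ℝ) ^ 2) * θ = ((F.L : ℝ) ^ j * θ) / (2 * γ) := by
        field_simp
      rw [this, le_div_iff₀ (by positivity)]
      linarith
  -- conclude `a − a' ≤ θ w'`
  have hfin : a - a' ≤ θ * w' := by
    have h1 : (a - a') * 1 ≤ (a - a') * ((F.L : ℝ) ^ j / γ * (1 / 2 * r ^ 2) * θ) :=
      mul_le_mul_of_nonneg_left hcoef (by linarith)
    have h2 : (a - a') * ((F.L : ℝ) ^ j / γ * (1 / 2 * r ^ 2) * θ) = θ * ((F.L : ℝ) ^ j / γ * ((a - a') * (1 / 2 * r ^ 2))) := by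
      ring
    have h3 : θ * ((F.L : ℝ) ^ j / γ * ((a - a') * (1 / 2 * r ^ 2))) ≤ θ * w' := mul_le_mul_of_nonneg_left hmain hθ.le
    linarith
  linarith

/-- `#Site_j = (2L^{m+j})³` at level `0` of the `j`-th approximation. -/
theorem card_site_eq (F : T3Family) (j : ℕ) :
    Fintype.card (Site (F.P j) 0) = (2 * F.L ^ (F.m + j)) ^ 3 := by
  have h1 : Fintype.card (Site (F.P j) 0) = Fintype.card (Fin (F.P j).d → ZMod ((F.P j).sitesPerDir 0)) := rfl
  rw [h1, Fintype.card_fun, ZMod.card, Fintype.card_fin, T3Family.P_d]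
  simp [Params.sitesPerDir]

/-- `#PBond_j = 3·#Site_j`. -/
theorem card_pbond_eq (F : T3Family) (j : ℕ) :
    Fintype.card (PBond (F.P j) 0) = Fintype.card (Site (F.P j) 0) * 3 := by
  have e : PBond (F.P j) 0 ≃ Site (F.P j) 0 × Fin (F.P j).d :=
    ⟨fun b => (b.src, b.dir), fun p => ⟨p.1, p.2⟩, fun _ => rfl, fun _ => rfl⟩
  rw [Fintype.card_congr e, Fintype.card_prod, Fintype.card_fin, T3Family.P_d]

/-- `L^{3j} ≤ #PBond_j`. -/
theorem pow_le_card_pbond (F : T3Family) (j : ℕ) :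
    F.L ^ (3 * j) ≤ Fintype.card (PBond (F.P j) 0) := by
  rw [card_pbond_eq, card_site_eq]
  have hL1 : 1 ≤ F.L := by have := F.hL.2; omega
  have h1 : F.L ^ j ≤ 2 * F.L ^ (F.m + j) := by
    have : F.L ^ j ≤ F.L ^ (F.m + j) := Nat.pow_le_pow_right hL1 (by omega)
    omega
  calc F.L ^ (3 * j) = (F.L ^ j) ^ 3 := by rw [← pow_mul, Nat.mul_comm]
    _ ≤ (2 * F.L ^ (F.m + j)) ^ 3 := Nat.pow_le_pow_left h1 3
    _ ≤ (2 * F.L ^ (F.m + j)) ^ 3 * 3 := Nat.le_mul_of_pos_right _ (by norm_num)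

/-- The volume factor of the organ's floor clause is at least `L^{6j}`: `(1 + 2(L^j/γ)#Plaq_j)#PBond_j² ≥ #PBond_j² ≥ L^{6j}`. -/
theorem volumeFactor_ge' (F : T3Family) (γ : ℝ) (hγ : 0 < γ) (j : ℕ) :
    ((F.L : ℝ) ^ 6) ^ j ≤ (1 + 2 * ((F.L : ℝ) ^ j / γ) * (Fintype.card (Plaq (F.P j) 0) : ℝ)) * (Fintype.card (PBond (F.P j) 0) : ℝ) ^ 2 := by
  have hB : ((F.L : ℝ) ^ (3 * j)) ≤ (Fintype.card (PBond (F.P j) 0) : ℝ) := by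
    exact_mod_cast pow_le_card_pbond F j
  have hB0 : 0 ≤ (F.L : ℝ) ^ (3 * j) := by positivity
  have h2 : (1 : ℝ) ≤ 1 + 2 * ((F.L : ℝ) ^ j / γ) * (Fintype.card (Plaq (F.P j) 0) : ℝ) := by
    have : 0 ≤ 2 * ((F.L : ℝ) ^ j / γ) * (Fintype.card (Plaq (F.P j) 0) : ℝ) := by positivity
    linarith
  have hpow : ((F.L : ℝ) ^ 6) ^ j = ((F.L : ℝ) ^ (3 * j)) ^ 2 := by rw [← pow_mul, ← pow_mul]; ring_nf
  calc ((F.L : ℝ) ^ 6) ^ j = ((F.L : ℝ) ^ (3 * j)) ^ 2 := hpow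
    _ ≤ (Fintype.card (PBond (F.P j) 0) : ℝ) ^ 2 := pow_le_pow_left₀ hB0 hB 2
    _ = 1 * (Fintype.card (PBond (F.P j) 0) : ℝ) ^ 2 := by ring
    _ ≤ (1 + 2 * ((F.L : ℝ) ^ j / γ) * (Fintype.card (Plaq (F.P j) 0) : ℝ)) * (Fintype.card (PBond (F.P j) 0) : ℝ) ^ 2 :=
        mul_le_mul_of_nonneg_right h2 (by positivity)

/-- **THE REDUCTION** (kernel-checked; the only sorry upstream is the construction stub): a twisted pair with ratio law in `[2, L⁶]` and affine rigidity refute the organ as filed (`ε_j → 0`, `C·a_{j+1} → 0`, and the floor `δ_j = o(L^{-6j}) ≤ a_{j+1}/4` by `volumeFactor_ge'` and the lower envelope `a_{j+1} ≥ a_0 L^{-6(j+1)}`, against `a_j ≥ 2a_{j+1}`). -/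
theorem not_oneStepBackwardContraction_of
    (hT : ∀ γ₁ : ℝ, 0 < γ₁ → ∃ (F : T3Family) (γ : ℝ), 0 < γ ∧ γ ≤ γ₁ ∧ γ ≤ 1 ∧ ∃ (b₀ p₀ : ℝ), 0 < b₀ ∧ 0 < p₀ ∧
    ∃ (κ : ℝ) (j₀ : ℕ) (prm : ℕ → ClassParams) (η : ℕ → ℝ), 0 < κ ∧ (∀ j, 0 ≤ η j) ∧ Summable η ∧
    ∃ (μ μ' : ((j : ℕ) → MeasureTheory.Measure (GaugeField (F.P j) 0 ↥(Matrix.specialUnitaryGroup (Fin 2) ℂ))))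
      (ρ ρ' : ((j : ℕ) → GaugeField (F.P j) 0 ↥(Matrix.specialUnitaryGroup (Fin 2) ℂ) → ℝ)),
    (∀ j : ℕ, IsProbabilityMeasure (μ j) ∧ μ j = Measure.map (descend F ℰp j) (μ (j + 1))) ∧
    (∀ j : ℕ, IsProbabilityMeasure (μ' j) ∧ μ' j = Measure.map (descend F ℰp j) (μ' (j + 1))) ∧
    (∀ j : ℕ, j₀ ≤ j → ((∀ U, PlaqSmall (θBal F.L γ b₀ p₀ j) U → 0 < ρ j U ∧ 0 < ρ' j U) ∧ μ j = (fieldMeasure _ _ _).withDensity (fun U => ENNReal.ofReal (ρ j U)) ∧ μ' j = (fieldMeasure _ _ _).withDensity (fun U => ENNReal.ofReal (ρ' j U)) ∧ MemAtHeight F ℰp j (prm j) (ρ j) ∧ MemAtHeight F ℰp j (prm j) (ρ' j) ∧ μ j {U | ¬ PlaqSmall (θBal F.L γ b₀ p₀ j) U} ≤ ENNReal.ofReal (η j) ∧ μ' j {U | ¬ PlaqSmall (θBal F.L γ b₀ p₀ j) U} ≤ ENNReal.ofReal (η j) ∧ (ContinuousOn (ρ j) {U | PlaqSmall (θBal F.L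 γ b₀ p₀ j) U} ∧ ContinuousOn (ρ' j) {U | PlaqSmall (θBal F.L γ b₀ p₀ j) U}))) ∧
    ∃ (a k : ℕ → ℝ), (∀ j, 0 < a j) ∧ (∀ j, 2 * a (j + 1) ≤ a j ∧ a j ≤ (F.L : ℝ) ^ 6 * a (j + 1)) ∧
    (∀ (j : ℕ) (U : GaugeField (F.P j) 0 ↥(Matrix.specialUnitaryGroup (Fin 2) ℂ)), PlaqSmall (θBal F.L γ b₀ p₀ j) U →
      Real.log (ρ j U) - Real.log (ρ' j U) = ((F.L : ℝ) ^ j / γ) * ∑ p, a j * (1 - reTr (GaugeField.plaqHol U p)) + k j))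
    (hR : ∀ (F : T3Family) (γ b₀ p₀ : ℝ), 0 < γ → γ ≤ 1 → 0 < b₀ → 0 < p₀ → ∀ θ : ℝ, 0 < θ → ∃ j₂ : ℕ, ∀ j : ℕ, j₂ ≤ j →
    ∀ (κ a a' w' k : ℝ) (c' : Plaq (F.P j) 0 → ℝ), 0 ≤ a → 0 ≤ a' → 0 ≤ w' → (∀ p, |c' p| ≤ a') →
    (∀ (b b' : PBond (F.P j) 0) (U V W Z : GaugeField (F.P j) 0 ↥(Matrix.specialUnitaryGroup (Fin 2) ℂ)), PlaqSmall (θBal F.L γ b₀ p₀ j) U → PlaqSmall (θBal F.L γ b₀ p₀ j) V → PlaqSmall (θBal F.L γ b₀ p₀ j) W → PlaqSmall (θBal F.L γ b₀ p₀ j) Z → (∀ e, e ≠ b → U e = V e) → (∀ e, e ≠ b' → U e = W e) → (∀ e, e ≠ b' → V e = Z e) → (∀ e, e ≠ b → W e = Z e) →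
      |((((F.L : ℝ) ^ j / γ) * ∑ p, a * (1 - reTr (GaugeField.plaqHol U p)) + k) - ((F.L : ℝ) ^ j / γ) * ∑ p, c' p * (1 - reTr (GaugeField.plaqHol U p))) - ((((F.L : ℝ) ^ j / γ) * ∑ p, a * (1 - reTr (GaugeField.plaqHol V p)) + k) - ((F.L : ℝ) ^ j / γ) * ∑ p, c' p * (1 - reTr (GaugeField.plaqHol V p))) - (((((F.L : ℝ) ^ j / γ) * ∑ p, a * (1 - reTr (GaugeField.plaqHol W p)) + k) - ((F.L : ℝ) ^ j / γ) * ∑ p, c' p * (1 - reTr (GaugeField.plaqHol W p))) - ((((F.L : ℝ) ^ j / γ) * ∑ p, a * (1 - reTr (GaugeField.plaqHol Z p)) + k) - ((F.L : ℝ) ^ j / γ) * ∑ p, c' p * (1 - reTr (GaugeField.plaqHol Z p))))| ≤ w' * Real.exp (-(κ * (b.src.tdist b'.src : ℝ)))) →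
    a ≤ a' + θ * w') :
    ¬ OneStepBackwardContraction := by
  intro hO
  obtain ⟨γ₁, hγ₁, h⟩ := hO
  obtain ⟨F, γ, hγ, hle, hγ1, b₀, p₀, hb₀, hp₀, κ, j₀, prm, η, hκ, hη, hηs, μ, μ', ρ, ρ', hc, hc', hB, a, k, ha, ha2, hAff⟩ :=
    hT γ₁ hγ₁
  obtain ⟨θ, C, w₀, ε, δ, j₁, hθ, hC, hw₀, hεδ, hεs, hδs, hDs, hdec, hj01, hstep⟩ :=
    h F γ hγ hle b₀ p₀ κ j₀ prm η hκ hη hηs μ μ' ρ ρ' hc hc' hB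
  obtain ⟨j₂, hrig⟩ := hR F γ b₀ p₀ hγ hγ1 hb₀ hp₀ θ hθ
  -- the window of ratios: `2 ≤ a_j/a_{j+1} ≤ L⁶ =: r`
  set r : ℝ := (F.L : ℝ) ^ 6 with hrdef
  have hL1 : (1 : ℝ) ≤ (F.L : ℝ) := by exact_mod_cast (show 1 ≤ F.L by have := F.hL.2; omega)
  have hr1 : 1 ≤ r := by rw [hrdef]; exact one_le_pow₀ hL1
  have hr0 : 0 < r := by linarith
  -- the two geometric envelopes of `a`
  have ha_up : ∀ j, a j ≤ a 0 * (1 / 2 : ℝ) ^ j := by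
    intro j
    induction j with
    | zero => simp
    | succ n ih =>
      have h := (ha2 n).1
      calc a (n + 1) ≤ a n / 2 := by linarith
        _ ≤ a 0 * (1 / 2 : ℝ) ^ n / 2 := by linarith
        _ = a 0 * (1 / 2 : ℝ) ^ (n + 1) := by rw [pow_succ]; ring
  have ha_low : ∀ j, a 0 * (1 / r) ^ j ≤ a j := by
    intro j
    induction j with
    | zero => simp
    | succ n ih =>
      have h := (ha2 n).2
      have h1 : a n / r ≤ a (n + 1) := by rw [div_le_iff₀ hr0]; linarith
      calc a 0 * (1 / r) ^ (n + 1) = a 0 * (1 / r) ^ n / r := by rw [pow_succ]; field_simp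
        _ ≤ a n / r := by exact div_le_div_of_nonneg_right ih hr0.le
        _ ≤ a (n + 1) := h1
  have ha_tend : Tendsto a atTop (𝓝 0) := by
    have h12 : Tendsto (fun j => a 0 * (1 / 2 : ℝ) ^ j) atTop (𝓝 (a 0 * 0)) :=
      (tendsto_pow_atTop_nhds_zero_of_lt_one (by norm_num) (by norm_num)).const_mul (a 0)
    rw [mul_zero] at h12
    exact tendsto_of_tendsto_of_tendsto_of_le_of_le tendsto_const_nhds h12 (fun j => (ha j).le) ha_up
  -- (i) eventually ε_j ≤ 1/4
  obtain ⟨N₁, hN₁⟩ : ∃ N, ∀ j, N ≤ j → ε j ≤ 1 / 4 := by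
    have := (hεs.tendsto_atTop_zero).eventually (Iic_mem_nhds (show (0 : ℝ) < 1 / 4 by norm_num))
    obtain ⟨N, hN⟩ := eventually_atTop.mp this
    exact ⟨N, hN⟩
  -- (ii) eventually C·a_{j+1} ≤ 1/4 and a_{j+1} ≤ w₀
  obtain ⟨N₂, hN₂⟩ : ∃ N, ∀ j, N ≤ j → C * a (j + 1) ≤ 1 / 4 ∧ a (j + 1) ≤ w₀ := by
    have ht : Tendsto (fun j => a (j + 1)) atTop (𝓝 0) := ha_tend.comp (tendsto_add_atTop_nat 1)
    have hCt : Tendsto (fun j => C * a (j + 1)) atTop (𝓝 (C * 0)) := ht.const_mul C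
    rw [mul_zero] at hCt
    have e1 := hCt.eventually (Iic_mem_nhds (show (0 : ℝ) < 1 / 4 by norm_num))
    have e2 := ht.eventually (Iic_mem_nhds hw₀)
    obtain ⟨N, hN⟩ := eventually_atTop.mp (e1.and e2)
    exact ⟨N, hN⟩
  -- (iii) eventually δ_j ≤ a_{j+1}/4, from the floor's own decay clause and the volume factor ≥ L^{6j} = r^j
  obtain ⟨N₃, hN₃⟩ : ∃ N, ∀ j, N ≤ j → δ j ≤ a (j + 1) / 4 := by
    have hpos8 : (0 : ℝ) < a 0 / (8 * r) := by have := ha 0; positivity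
    have e := hdec.eventually (Iic_mem_nhds hpos8)
    obtain ⟨N, hN⟩ := eventually_atTop.mp e
    refine ⟨N, fun j hj => ?_⟩
    have hX : r ^ j ≤ (1 + 2 * ((F.L : ℝ) ^ j / γ) * (Fintype.card (Plaq (F.P j) 0) : ℝ)) *
        (Fintype.card (PBond (F.P j) 0) : ℝ) ^ 2 := volumeFactor_ge' F γ hγ j
    have hsumj : Summable (fun k => δ (k + j)) := (summable_nat_add_iff j).mpr hδs
    have hTj : δ j ≤ ∑' k, δ (k + j) := by
      have := hsumj.le_tsum 0 (fun k _ => (hεδ (k + j)).2)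
      simpa using this
    have hT0 : 0 ≤ ∑' k, δ (k + j) := tsum_nonneg fun k => (hεδ (k + j)).2
    have hprod : (∑' k, δ (k + j)) * ((1 + 2 * ((F.L : ℝ) ^ j / γ) * (Fintype.card (Plaq (F.P j) 0) : ℝ)) *
        (Fintype.card (PBond (F.P j) 0) : ℝ) ^ 2) ≤ a 0 / (8 * r) := hN j hj
    have hrj : 0 < r ^ j := by positivity
    -- δ_j · r^j ≤ T_j · X_j ≤ a0/(8r), and a (j+1) = a0 (1/r)^(j+1)
    have hδ2 : δ j * r ^ j ≤ a 0 / (8 * r) := by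
      calc δ j * r ^ j ≤ (∑' k, δ (k + j)) * r ^ j := by
            exact mul_le_mul_of_nonneg_right hTj hrj.le
        _ ≤ (∑' k, δ (k + j)) * ((1 + 2 * ((F.L : ℝ) ^ j / γ) * (Fintype.card (Plaq (F.P j) 0) : ℝ)) *
              (Fintype.card (PBond (F.P j) 0) : ℝ) ^ 2) := mul_le_mul_of_nonneg_left hX hT0
        _ ≤ a 0 / (8 * r) := hprod
    have haj : a 0 * (1 / r) ^ (j + 1) ≤ a (j + 1) := ha_low (j + 1)
    -- δ j ≤ (a0/(8r)) / r^j = a0 (1/r)^(j+1) / 8 ≤ a (j+1) / 8 ≤ a (j+1) / 4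
    have : δ j ≤ a 0 / (8 * r) / r ^ j := by rwa [le_div_iff₀ hrj]
    calc δ j ≤ a 0 / (8 * r) / r ^ j := this
      _ = a 0 * (1 / r) ^ (j + 1) / 8 := by
          have hrne : r ^ j ≠ 0 := hrj.ne'
          rw [one_div_pow, pow_succ]
          field_simp
      _ ≤ a (j + 1) / 8 := by linarith
      _ ≤ a (j + 1) / 4 := by linarith [ha (j + 1)]
  -- the height
  set j := max (max j₁ j₂) (max (max N₁ N₂) N₃) with hjdef
  have hj1 : j₁ ≤ j := le_trans (le_max_left _ _) (le_max_left _ _)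
  have hj2 : j₂ ≤ j := le_trans (le_max_right _ _) (le_max_left _ _)
  have hjN1 : N₁ ≤ j := le_trans (le_trans (le_max_left _ _) (le_max_left _ _)) (le_max_right _ _)
  have hjN2 : N₂ ≤ j := le_trans (le_trans (le_max_right _ _) (le_max_left _ _)) (le_max_right _ _)
  have hjN3 : N₃ ≤ j := le_trans (le_max_right _ _) (le_max_right _ _)
  have hε4 := hN₁ j hjN1
  obtain ⟨hCa, haw₀⟩ := hN₂ j hjN2
  have hδ4 := hN₃ j hjN3
  have haj1 := ha (j + 1)
  -- the organ's hypothesis at height j+1 holds with (c ≡ a_{j+1}, a_{j+1}, w = 0)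
  have hk : ∀ X : GaugeField (F.P (j + 1)) 0 ↥(Matrix.specialUnitaryGroup (Fin 2) ℂ), PlaqSmall (θBal F.L γ b₀ p₀ (j + 1)) X →
      Real.log (ρ (j + 1) X) - Real.log (ρ' (j + 1) X) -
        ((F.L : ℝ) ^ (j + 1) / γ) * ∑ p, a (j + 1) * (1 - reTr (GaugeField.plaqHol X p)) =
        k (j + 1) := by
    intro X hX
    rw [hAff (j + 1) X hX]
    ring
  have hadm : (∀ p : Plaq (F.P (j + 1)) 0, |a (j + 1)| ≤ a (j + 1)) ∧
      (∀ (b b' : PBond (F.P (j + 1)) 0) U V W Z, PlaqSmall (θBal F.L γ b₀ p₀ (j + 1)) U → PlaqSmall (θBal F.L γ b₀ p₀ (j + 1)) V → PlaqSmall (θBal F.L γ b₀ p₀ (j + 1)) W → PlaqSmall (θBal F.L γ b₀ p₀ (j + 1)) Z → (∀ e, e ≠ b → U e = V e) → (∀ e, e ≠ b' → U e = W e) → (∀ e, e ≠ b' → V e = Z e) → (∀ e, e ≠ b → W e = Z e) → |(Real.log (ρ (j + 1) U) - Real.log (ρ' (j + 1) U) - ((F.L : ℝ) ^ (j + 1)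 / γ) * ∑ p, a (j + 1) * (1 - reTr (GaugeField.plaqHol U p))) - (Real.log (ρ (j + 1) V) - Real.log (ρ' (j + 1) V) - ((F.L : ℝ) ^ (j + 1) / γ) * ∑ p, a (j + 1) * (1 - reTr (GaugeField.plaqHol V p))) - ((Real.log (ρ (j + 1) W) - Real.log (ρ' (j + 1) W) - ((F.L : ℝ) ^ (j + 1) / γ) * ∑ p, a (j + 1) * (1 - reTr (GaugeField.plaqHol W p))) - (Real.log (ρ (j + 1) Z) - Real.log (ρ' (j + 1) Z) - ((F.L : ℝ) ^ (j + 1) / γ) * ∑ p, a (j + 1) * (1 - reTr (GaugeField.plaqHol Z p))))| ≤ 0 * Real.exp (-(κ * (b.src.tdist b'.src : ℝ)))) := by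
    refine ⟨fun p => by simp [abs_of_pos haj1], ?_⟩
    intro b b' U V W Z hU hV hW hZ _ _ _ _
    rw [hk U hU, hk V hV, hk W hW, hk Z hZ]
    simp
  obtain ⟨c', a', w', ha', hw', hbound, hadm'⟩ :=
    hstep j hj1 (fun _ => a (j + 1)) (a (j + 1)) 0 haj1.le le_rfl (by simpa using haw₀) hadm
  -- the organ's conclusion at height j, rewritten through the affine form, feeds affine rigidity
  have hrig' : a j ≤ a' + θ * w' := by
    refine hrig j hj2 κ (a j) a' w' (k j) c' (ha j).le ha' hw' hadm'.1 ?_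
    intro b b' U V W Z hU hV hW hZ h1 h2 h3 h4
    have := hadm'.2 b b' U V W Z hU hV hW hZ h1 h2 h3 h4
    rw [hAff j U hU, hAff j V hV, hAff j W hW, hAff j Z hZ] at this
    exact this
  -- arithmetic: a_j ≥ 2 a_{j+1}, ε_j ≤ 1/4, C a_{j+1} ≤ 1/4, δ_j ≤ a_{j+1}/4
  have h2a : 2 * a (j + 1) ≤ a j := (ha2 j).1
  have hb' : a' + θ * w' ≤ (1 + ε j + C * (a (j + 1) + θ * 0)) * (a (j + 1) + θ * 0) + δ j := hbound
  simp only [mul_zero, add_zero] at hb'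
  have hεa : ε j * a (j + 1) ≤ (1 / 4) * a (j + 1) := mul_le_mul_of_nonneg_right hε4 haj1.le
  have hCaa : C * a (j + 1) * a (j + 1) ≤ (1 / 4) * a (j + 1) := mul_le_mul_of_nonneg_right hCa haj1.le
  nlinarith

/-- The reduction applied to the construction stub and the PROVED rigidity: `¬ OneStepBackwardContraction` modulo exactly ONE sorry (`stub_twistedPair`). -/
theorem not_oneStepBackwardContraction_of_stubs : ¬ OneStepBackwardContraction :=
  not_oneStepBackwardContraction_of stub_twistedPair affineRigidity

end Summit.QuantumFields.YangMills.Cruxes.OneStepBackwardContraction.TwistedFibre
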